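import Mathlib
import Summits.NavierStokesRegularity.NavierStokesRegularity.Theorems.FilamentSkeletonRssMatchedKernelNormalBlockBox

/-!
# `SkeletonJ1` (stmt-NavierStokesRegularity-27413, Variant A1α) · birth skeleton `Lines/birth.lean` (12616aef6aab368d) ·
# registered stub `stub_normalBlock : NormalBlock` — the CORE-WINDOW FORM, and the area-law bricks at the stagnation point

WHAT IS PROVED (sorry-free, standard axioms).
1. `normalBlock_of_coreWindow` — the text of the registered stub `NormalBlock` (clause 12: the normal block of `A_j = Dv(X_j(c_j))` has
   trace `< 0` and determinant `> 0` in ANY orthonormal completion `(X_j′(c_j), m_j, n_j)`, from the other clauses of `SkeletonJ1`, `2Kρ ≤ 1`,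
   `Γ ≥ Γ₁(consts)`) with exactly ONE hypothesis added: a two-sided CORE WINDOW `m₁ ≤ κ·Aa_k(σ)` (all filaments, all `σ`) and
   `κ·Aa_j(σ) ≤ m₂` for `|σ − c_j| ≤ √m₂` (`κ = e^{−(1+γ_E−log 2)}`), the constants `m₁, m₂ > 0` being bound with the box constants.  Proof =
   the landed matched-kernel theorem `MatchedKernel.matched_clause12_of_skeleton_core` (p599125 → matched port, lane 19175-p1) read over the
   A1α clause block (area law instead of the cone clause; the frames are the skeleton's own, universally quantified, as in the stub).
   (A GLOBAL core box `Λ⁻¹ ≤ Aa ≤ KA′` — the near-straight regime's floor plus a ceiling — is the window with `m₁ = κ(max Λ 1)⁻¹`, `m₂ = κ·max KA′ 1`.)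
2. AREA-LAW BRICKS (pure real analysis; the tenure design note DESIGN-NOTE-28296-tenure-g22 §3 (I3) «slip floor», not previously in the tree):
   under `w·Aa′ = (3/2 − w′)·Aa + 4` with `Aa > 0`, `w`, `Aa` differentiable and `w(c) = 0`:
   `(w·Aa)′ = (3/2)·Aa + 4` (`areaLaw_hasDerivAt_mul`), the one-sided laws `4(τ − c) ≤ w·Aa` (`τ ≥ c`) / `w·Aa ≤ 4(τ − c)` (`τ ≤ c`), the SLIP FLOOR
   `4|τ − c| ≤ |w(τ)|·Aa(τ)` (`areaLaw_slip_floor`), hence the UNIQUE ZERO FOR FREE `w τ = 0 → τ = c` (`areaLaw_zero_unique`: the second conjunct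
   of clause 11 of `SkeletonJ1` is implied by the area-law conjunct), the sign law, and at the zero `Aa(c) = 4/(w′(c) − 3/2) ∈ [4/(Λ − 3/2), 4/δ]`
   (`areaLaw_core_at_zero`, `areaLaw_core_bounds_at_zero`; the argument of the landed `coreAreaNecessity_proof`) — i.e. the core window HOLDS AT `σ = c_j`
   with `m₁ = 4κ/(Λ − 3/2)`, `m₂ = 4κ/δ` from the clauses alone.
3. (§3, appended) FLOOR FOR FREE in the near-straight regime: area law + `|w′| ≤ Λ` ⇒ `4/Λ ≤ Aa(τ)` for all `τ` (`areaLaw_floor_of_deriv_bound`,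
   `areaLaw_inv_le_of_deriv_bound`) — the conjunct `Λ⁻¹ ≤ Aa` of `NearStraightJ1G` is implied by `|w′| ≤ Λ` for the area-law variants.
4. (§4, appended) AREA-LAW TWIN (design note (I2)): `w·μ′ = (3/4 − w′/2)·μ + 2κ/μ` for `μ = √(κ·Aa)` (`areaLaw_coreRadius`) and the damping form
   `w·(ρ/μ)′ = −(2κ/μ²)(ρ/μ) + r/μ` for any amplitude with `w·ρ′ = (3/4 − w′/2)ρ + r` (`areaLaw_ratio_damping`).  (The CEILING near a uniformly
   supercritical zero is in the companion `…SkeletonJ1NormalBlockCeiling`, the assembly in `…SkeletonJ1NormalBlockSlipRegular`.)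
WHAT IS NOT PROVED, AND WHY (repair census for the registered text).  The registered `NormalBlock` has NO core window: away from `σ = c_j` the
area law controls `Aa` only through `w` (`Aa = (w·Aa)/w`, `(w·Aa)′ = 1.5·Aa + 4`), and the clause block bounds `w′` at `c_j` only — so a
Γ-uniform window `κ·Aa_j(σ) ∈ [m₁, m₂]` on `|σ − c_j| ≤ √m₂` needs a modulus for `w′` near `c_j` (equivalently for the tangential strain
`⟪Dv·X′, X′⟫` along the filament), which the A1α text does not carry.  This is the same gap the lane met on the A1G twin (27849: registered
`NormalBlockMatched` from `FlatJ1G` alone → proved in the RESHAPED near-straight form, p647414/p648664, skeleton reshaped by tenure).  The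
precise missing lemma is stated in the docstring of `normalBlock_of_coreWindow`.
HONEST FRAMING: bookkeeping about a HYPOTHETICAL filament skeleton on the NEGATIVE side of a MODEL route (A1α aside, superseded by A1G/A1L/A1R);
`SkeletonJ1` stays OPEN; nothing here bears on Navier–Stokes regularity or blow-up.  `--supports stmt-NavierStokesRegularity-27413`.
-/

set_option linter.dupNamespace false

noncomputable section

namespace Summit.NavierStokesRegularity.NavierStokesRegularity.Theorems.SkeletonJ1NormalBlockWindow

open Set Function Filter MeasureTheory Real
open Literature.Analysis.FluidPDE
open Summit.NavierStokesRegularity.NavierStokesRegularity.Theorems.MatchedKernel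
open scoped InnerProductSpace Topology

/-! ## 1. Area-law bricks (design note §3 (I3)): `(w·Aa)′ = 1.5·Aa + 4`, slip floor, unique zero for free, the core AT the zero -/

/-- Under the similarity-frame core-area law `w·A′ = (3/2 − w′)·A + 4` (with `w`, `A` differentiable) the product `w·A` has derivative
`(3/2)·A + 4` everywhere. [folklore] -/
theorem areaLaw_hasDerivAt_mul {w A : ℝ → ℝ} (hw : Differentiable ℝ w) (hA : Differentiable ℝ A)
    (hlaw : ∀ τ, w τ * deriv A τ = (3 / 2 - deriv w τ) * A τ + 4) (τ : ℝ) :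
    HasDerivAt (fun s => w s * A s) (3 / 2 * A τ + 4) τ := by
  have h : HasDerivAt (fun s => w s * A s) (deriv w τ * A τ + w τ * deriv A τ) τ :=
    ((hw τ).hasDerivAt).mul ((hA τ).hasDerivAt)
  refine h.congr_deriv ?_
  rw [hlaw τ]; ring

/-- One-sided law to the right of the zero: `4(τ − c) ≤ w(τ)·A(τ)` for `c ≤ τ` (`A > 0`, `w(c) = 0`). [folklore] -/
theorem areaLaw_mul_ge {w A : ℝ → ℝ} {c : ℝ} (hw : Differentiable ℝ w) (hA : Differentiable ℝ A)
    (hlaw : ∀ τ, w τ * deriv A τ = (3 / 2 - deriv w τ) * A τ + 4) (hpos : ∀ τ, 0 < A τ) (hc : w c = 0)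
    {τ : ℝ} (hτ : c ≤ τ) : 4 * (τ - c) ≤ w τ * A τ := by
  have hg : ∀ s, HasDerivAt (fun s => w s * A s - 4 * s) (3 / 2 * A s) s := fun s => by
    have h2 : HasDerivAt (fun x : ℝ => 4 * x) 4 s := by
      simpa using (hasDerivAt_id s).const_mul (4 : ℝ)
    exact ((areaLaw_hasDerivAt_mul hw hA hlaw s).sub h2).congr_deriv (by ring)
  have hdiff : Differentiable ℝ (fun s => w s * A s - 4 * s) := fun s => (hg s).differentiableAt
  have hmono : Monotone (fun s => w s * A s - 4 * s) :=
    monotone_of_deriv_nonneg hdiff fun s => by rw [(hg s).deriv]; linarith [hpos s]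
  have h := hmono hτ
  simp only [hc, zero_mul] at h
  linarith

/-- One-sided law to the left of the zero: `w(τ)·A(τ) ≤ 4(τ − c)` for `τ ≤ c` (`A > 0`, `w(c) = 0`). [folklore] -/
theorem areaLaw_mul_le {w A : ℝ → ℝ} {c : ℝ} (hw : Differentiable ℝ w) (hA : Differentiable ℝ A)
    (hlaw : ∀ τ, w τ * deriv A τ = (3 / 2 - deriv w τ) * A τ + 4) (hpos : ∀ τ, 0 < A τ) (hc : w c = 0)
    {τ : ℝ} (hτ : τ ≤ c) : w τ * A τ ≤ 4 * (τ - c) := by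
  have hg : ∀ s, HasDerivAt (fun s => w s * A s - 4 * s) (3 / 2 * A s) s := fun s => by
    have h2 : HasDerivAt (fun x : ℝ => 4 * x) 4 s := by
      simpa using (hasDerivAt_id s).const_mul (4 : ℝ)
    exact ((areaLaw_hasDerivAt_mul hw hA hlaw s).sub h2).congr_deriv (by ring)
  have hdiff : Differentiable ℝ (fun s => w s * A s - 4 * s) := fun s => (hg s).differentiableAt
  have hmono : Monotone (fun s => w s * A s - 4 * s) :=
    monotone_of_deriv_nonneg hdiff fun s => by rw [(hg s).deriv]; linarith [hpos s]
  have h := hmono hτ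
  simp only [hc, zero_mul] at h
  linarith

/-- **SLIP FLOOR** (design note (I3)): `4|τ − c| ≤ |w(τ)|·A(τ)` — a quantitative unique zero of the slip `w`, for free from the area law.
[folklore] -/
theorem areaLaw_slip_floor {w A : ℝ → ℝ} {c : ℝ} (hw : Differentiable ℝ w) (hA : Differentiable ℝ A)
    (hlaw : ∀ τ, w τ * deriv A τ = (3 / 2 - deriv w τ) * A τ + 4) (hpos : ∀ τ, 0 < A τ) (hc : w c = 0)
    (τ : ℝ) : 4 * |τ - c| ≤ |w τ| * A τ := by
  have hwabs : w τ * A τ ≤ |w τ| * A τ := mul_le_mul_of_nonneg_right (le_abs_self _) (hpos τ).le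
  have hwabs' : -(w τ * A τ) ≤ |w τ| * A τ := by
    rw [← neg_mul]; exact mul_le_mul_of_nonneg_right (neg_le_abs _) (hpos τ).le
  rcases le_total c τ with hτ | hτ
  · rw [abs_of_nonneg (sub_nonneg.2 hτ)]
    linarith [areaLaw_mul_ge hw hA hlaw hpos hc hτ]
  · rw [abs_of_nonpos (sub_nonpos.2 hτ)]
    linarith [areaLaw_mul_le hw hA hlaw hpos hc hτ]

/-- **UNIQUE ZERO FOR FREE**: under the area law the slip `w` vanishes only at `c` — the second conjunct `∀ τ, w j τ = 0 → τ = c j` of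
clause 11 of `SkeletonJ1` is implied by the area-law conjunct. [folklore] -/
theorem areaLaw_zero_unique {w A : ℝ → ℝ} {c : ℝ} (hw : Differentiable ℝ w) (hA : Differentiable ℝ A)
    (hlaw : ∀ τ, w τ * deriv A τ = (3 / 2 - deriv w τ) * A τ + 4) (hpos : ∀ τ, 0 < A τ) (hc : w c = 0)
    {τ : ℝ} (hτ : w τ = 0) : τ = c := by
  have h := areaLaw_slip_floor hw hA hlaw hpos hc τ
  rw [hτ, abs_zero, zero_mul] at h
  have h' : |τ - c| ≤ 0 := by linarith
  exact sub_eq_zero.mp (abs_nonpos_iff.mp h')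

/-- Sign law: the slip is positive to the right of its zero. [folklore] -/
theorem areaLaw_pos_of_lt {w A : ℝ → ℝ} {c : ℝ} (hw : Differentiable ℝ w) (hA : Differentiable ℝ A)
    (hlaw : ∀ τ, w τ * deriv A τ = (3 / 2 - deriv w τ) * A τ + 4) (hpos : ∀ τ, 0 < A τ) (hc : w c = 0)
    {τ : ℝ} (hτ : c < τ) : 0 < w τ := by
  have h := areaLaw_mul_ge hw hA hlaw hpos hc hτ.le
  by_contra hneg
  push Not at hneg
  have : w τ * A τ ≤ 0 := mul_nonpos_of_nonpos_of_nonneg hneg (hpos τ).le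
  linarith

/-- Sign law: the slip is negative to the left of its zero. [folklore] -/
theorem areaLaw_neg_of_lt {w A : ℝ → ℝ} {c : ℝ} (hw : Differentiable ℝ w) (hA : Differentiable ℝ A)
    (hlaw : ∀ τ, w τ * deriv A τ = (3 / 2 - deriv w τ) * A τ + 4) (hpos : ∀ τ, 0 < A τ) (hc : w c = 0)
    {τ : ℝ} (hτ : τ < c) : w τ < 0 := by
  have h := areaLaw_mul_le hw hA hlaw hpos hc hτ.le
  by_contra hneg
  push Not at hneg
  have : 0 ≤ w τ * A τ := mul_nonneg hneg (hpos τ).le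
  linarith

/-- The core AT the zero (= the landed route support `CoreAreaNecessity`, stmt-15404, in this file's vocabulary): `3/2 < w′(c)` and `A(c) = 4/(w′(c) − 3/2)`.
[folklore] -/
theorem areaLaw_core_at_zero {w A : ℝ → ℝ} {c : ℝ}
    (hlaw : ∀ τ, w τ * deriv A τ = (3 / 2 - deriv w τ) * A τ + 4) (hpos : ∀ τ, 0 < A τ) (hc : w c = 0) :
    3 / 2 < deriv w c ∧ A c = 4 / (deriv w c - 3 / 2) := by
  -- the argument of the landed `coreAreaNecessity_proof` (route support item 15404), inlined to keep this module's imports minimal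
  have hbal := hlaw c
  rw [hc, zero_mul] at hbal
  have hprod : (deriv w c - 3 / 2) * A c = 4 := by linarith
  have hd : 0 < deriv w c - 3 / 2 := by
    by_contra h
    push Not at h
    nlinarith [mul_nonpos_of_nonpos_of_nonneg h (hpos c).le]
  refine ⟨by linarith, ?_⟩
  rw [eq_div_iff hd.ne', mul_comm]
  exact hprod

/-- The core window AT the zero from the waist clause: `3/2 + δ ≤ w′(c) ≤ Λ` gives `4/(Λ − 3/2) ≤ A(c) ≤ 4/δ`. [folklore] -/
theorem areaLaw_core_bounds_at_zero {w A : ℝ → ℝ} {c δ Λ : ℝ} (hδ : 0 < δ)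
    (hlaw : ∀ τ, w τ * deriv A τ = (3 / 2 - deriv w τ) * A τ + 4) (hpos : ∀ τ, 0 < A τ) (hc : w c = 0)
    (hlo : 3 / 2 + δ ≤ deriv w c) (hhi : deriv w c ≤ Λ) :
    4 / (Λ - 3 / 2) ≤ A c ∧ A c ≤ 4 / δ := by
  obtain ⟨-, hAc⟩ := areaLaw_core_at_zero hlaw hpos hc
  have hd : 0 < deriv w c - 3 / 2 := by linarith
  rw [hAc]
  refine ⟨?_, ?_⟩
  · exact div_le_div_of_nonneg_left (by norm_num) hd (by linarith)
  · exact div_le_div_of_nonneg_left (by norm_num) hδ (by linarith)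

/-! ## 2. The registered stub in its CORE-WINDOW form -/

/-- **`NormalBlock` (registered stub `stub_normalBlock` of the birth skeleton of `SkeletonJ1`, 12616aef6aab368d) — CORE-WINDOW FORM.**
The registered text VERBATIM (A1α clause block: flat clauses 0–11, area law, frames, clause 13-J, in the skeleton's order; conclusion = the two
normal-block inequalities for every `j` in the skeleton's OWN frame `(X_j′(c_j), m_j, n_j)`), with two extra box constants `m₁ m₂ > 0` and ONE
extra hypothesis after the clause block: the core window `(∀ k σ, m₁ ≤ κ·Aa k σ) ∧ (∀ j σ, |σ − c j| ≤ √m₂ → κ·Aa j σ ≤ m₂)`.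
Threshold `Γ₁ = max(exp((Rw/Rb)²+1), (7104πK m₂)²/m₁, 312π m₂(cgρ+2Rw)/(cg⁴ρ³), 4π m₂(12N(ρ+2Rw)/(θ₀cgρ³)+2θ₀⁻¹+2)/θ₀)`.
MISSING FOR THE REGISTERED TEXT (named precisely): a lemma `∃ m₁ m₂ > 0` (functions of the box constants only) such that every A1α skeleton
satisfying the clause block has the core window above — at `σ = c_j` it holds with `[4κ/(Λ−3/2), 4κ/δ]` (`areaLaw_core_bounds_at_zero`); off the
zero it needs a Γ-uniform modulus for `w′` near `c_j`, which the A1α clauses do not provide. [folklore] -/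
theorem normalBlock_of_coreWindow :
    ∀ (N:ℕ) (δ ρ K Λ a b cnd η Rw Rb cg θ₀ m₁ m₂:ℝ), 0 < N → 0 < δ → 0 < ρ → 0 ≤ a → 0 < η → 0 < Rw → 0 < Rb → 0 < cg → 0 < θ₀ → 0 < m₁ → 0 < m₂ → 2*K*ρ≤1 → ∃ Γ₁:ℝ, ∀ Γ:ℝ, Γ₁≤Γ → ∀ (γ:Fin N → ℝ) (α:ℝ) (X:Fin N → ℝ → EuclideanSpace ℝ (Fin 3)) (w:Fin N → ℝ → ℝ) (c:Fin N → ℝ) (m n:Fin N → EuclideanSpace ℝ (Fin 3)) (Aa:Fin N → ℝ → ℝ) (u:(Fin N → ℝ → EuclideanSpace ℝ (Fin 3)) → EuclideanSpace ℝ (Fin 3) → EuclideanSpace ℝ (Fin 3)) (v:EuclideanSpace ℝ (Fin 3) → EuclideanSpace ℝ (Fin 3)) (A:Fin N → (EuclideanSpace ℝ (Fin 3) →L[ℝ] EuclideanSpace ℝ (Fin 3))) (T:(Fin N → ℝ → EuclideanSpace ℝ (Fin 3)) → Fin N → ℝ → EuclideanSpace ℝ (Fin 3)), (∀ Z y, u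 Z y = ∑ k, (Γ*γ k/(4*Real.pi))•∫ σ:ℝ, ((‖y-Z k σ‖^2+Real.exp (-(1+Real.eulerMascheroniConstant-Real.log 2))*Aa k σ)^(3/2:ℝ))⁻¹•cross (deriv (Z k) σ) (y-Z k σ))→(∀ y, v y = u X y+(1/2:ℝ)•y-α•cross (EuclideanSpace.single 2 1) y)→(∀ j, A j = fderiv ℝ v (X j (c j)))→(∀ Z j τ, T Z j τ = (u Z (Z j τ)+(1/2:ℝ)•Z j τ-α•cross (EuclideanSpace.single 2 1) (Z j τ))-(⟪u Z (Z j τ)+(1/2:ℝ)•Z j τ-α•cross (EuclideanSpace.single 2 1) (Z j τ), deriv (Z j) τ⟫_ℝ/‖deriv (Z j) τ‖^2)•deriv (Z j) τ)→((α ≠ 0 ∧ (∀ j, γ j ≠ 0)∧(∀ j, ContDiff ℝ 2 (X j) ∧ Differentiable ℝ (w j)∧(∀ τ, ‖deriv (X j) τ‖ = 1)∧(∀ τ, ‖iteratedDeriv 2 (X j) τ‖*√Γ≤K) ∧ Tendsto (fun τ => ‖X j τ‖) (cocompact ℝ) atTop)∧(∀ j k, j ≠ k → ∀ τ σ, ρ*√Γ≤‖X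 j τ-X k σ‖)∧(∀ j τ σ, ρ*√Γ≤|τ-σ| → cg*ρ*√Γ≤‖X j τ-X j σ‖)∧(∀ j τ, cg*|τ-c j|≤Rw*√Γ+‖X j τ‖)∧(∀ j τ, w j τ = ⟪v (X j τ), deriv (X j) τ⟫_ℝ)∧(∀ j τ, ‖X j τ‖≤Rb*√(Γ*Real.log Γ) → v (X j τ) = w j τ•deriv (X j) τ)∧(∀ j, ‖X j (c j)‖≤Rw*√Γ)∧(∀ j, |⟪deriv (X j) (c j), EuclideanSpace.single 2 1⟫_ℝ|≤1-θ₀)∧(θ₀≤|α| ∧ |α|≤θ₀⁻¹ ∧ ∀ j, θ₀≤|γ j| ∧ |γ j|≤θ₀⁻¹)∧(∀ j, w j (c j) = 0 ∧ (∀ τ, w j τ = 0 → τ = c j) ∧ 3/2+δ≤deriv (w j) (c j) ∧ deriv (w j) (c j)≤Λ)∧(∀ j, Differentiable ℝ (Aa j) ∧ (∀ τ, 0 < Aa j τ) ∧ ∀ τ, w j τ*deriv (Aa j) τ = (3/2-deriv (w j) τ)*Aa j τ+4)∧(∀ j, Orthonormal ℝ ![deriv (X j) (c j), m j, n j])∧(∀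 Y:Fin N → ℝ → EuclideanSpace ℝ (Fin 3), (∀ j, ContDiff ℝ 2 (Y j))→(∀ j τ, ⟪Y j τ, deriv (X j) τ⟫_ℝ = 0) → (∀ j τ, Rb*√(Γ*Real.log Γ) < ‖X j τ‖ → Y j τ = 0) → ∑ j, ⟪Y j (c j), cross (EuclideanSpace.single 2 1) (X j (c j))⟫_ℝ = 0 → (∀ j τ, ‖Y j τ‖+‖deriv (Y j) τ‖+‖iteratedDeriv 2 (Y j) τ‖≤(1+|τ-c j|)^b) → ∀ L:ℝ, (∀ j τ, ‖deriv (fun s:ℝ => T (fun k σ => X k σ+s•Y k σ) j τ) 0‖≤L*(1+|τ-c j|)^a) → ∀ j τ, ‖Y j τ‖≤cnd*L*(1+|τ-c j|)^b))) → ((∀ k σ, m₁ ≤ Real.exp (-(1+Real.eulerMascheroniConstant-Real.log 2)) * Aa k σ) ∧ (∀ j σ, |σ - c j| ≤ √m₂ → Real.exp (-(1+Real.eulerMascheroniConstant-Real.log 2)) * Aa j σ ≤ m₂)) → ∀ j, ⟪A j (m j), m j⟫_ℝ+⟪A j (n j), n j⟫_ℝ < 0 ∧ ⟪A j (n j), m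 j⟫_ℝ * ⟪A j (m j), n j⟫_ℝ < ⟪A j (m j), m j⟫_ℝ * ⟪A j (n j), n j⟫_ℝ := by
  intro N δ ρ K Λ a b cnd η Rw Rb cg θ₀ m₁ m₂ hN hδ hρ ha hη hRw hRb hcg hθ₀ hm₁ hm₂ hKρ
  refine ⟨max (max (Real.exp ((Rw / Rb) ^ 2 + 1)) ((7104 * Real.pi * K * m₂) ^ 2 / m₁))
      (max (312 * Real.pi * m₂ * (cg * ρ + 2 * Rw) / (cg ^ 4 * ρ ^ 3))
        (4 * Real.pi * m₂ * (12 * N * (ρ + 2 * Rw) / (θ₀ * cg * ρ ^ 3) + 2 * θ₀⁻¹ + 2) / θ₀)), ?_⟩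
  intro Γ hΓ γ α X w c m n Aa u v A T hu hv hA hT hsk hwin j
  have hΓ1 : Real.exp ((Rw / Rb) ^ 2 + 1) ≤ Γ := ((le_max_left _ _).trans (le_max_left _ _)).trans hΓ
  have hΓ2 : (7104 * Real.pi * K * m₂) ^ 2 / m₁ ≤ Γ := ((le_max_right _ _).trans (le_max_left _ _)).trans hΓ
  have hΓ3 : 312 * Real.pi * m₂ * (cg * ρ + 2 * Rw) / (cg ^ 4 * ρ ^ 3) ≤ Γ :=
    ((le_max_left _ _).trans (le_max_right _ _)).trans hΓ
  have hΓ4 : 4 * Real.pi * m₂ * (12 * N * (ρ + 2 * Rw) / (θ₀ * cg * ρ ^ 3) + 2 * θ₀⁻¹ + 2) / θ₀ ≤ Γ :=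
    ((le_max_right _ _).trans (le_max_right _ _)).trans hΓ
  obtain ⟨-, -, hreg, hsep, hnoret, hesc, -, htan, hwaist, -, hbds, hstag, harea, hON, -⟩ := hsk
  obtain ⟨hm₁A, hm₂A⟩ := hwin
  have h12 := matched_clause12_of_skeleton_core hδ hρ hRw hRb hcg hθ₀ hm₁ hm₂ hKρ hΓ1 hΓ2 hΓ3 hΓ4 hu
    (fun k => (harea k).1) hm₁A hm₂A hv
    (fun k => ⟨(hreg k).1, (hreg k).2.1, (hreg k).2.2.1, (hreg k).2.2.2.1⟩) hsep hnoret hesc htan hwaist hbds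
    (fun k => ⟨(hstag k).1, (hstag k).2.2.1⟩) j (hON j)
  rw [hA j]
  exact h12

/-! ## 3. The core FLOOR for free in the near-straight regime: area law + `|w′| ≤ Λ` ⇒ `4/Λ ≤ Aa` everywhere
(appended 2026-08-31, same hand): the third conjunct `Λ⁻¹ ≤ Aa` of the near-straight regime `NearStraightJ1G` is IMPLIED, for the area-law
variants (A1α `SkeletonJ1` 27413 / A1G `SkeletonJ1G` 27849), by its second conjunct `|w′| ≤ Λ` and the area-law clause — so of the core
window of §2 the FLOOR `m₁ = 4κ/Λ` is free in that regime and only the CEILING off the zero remains owed. -/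

/-- Slip Lipschitz bound: `|w′| ≤ Λ` and `w(c) = 0` give `|w(τ)| ≤ Λ·|τ − c|` (mean value inequality). [folklore] -/
theorem slip_abs_le_of_deriv_bound {w : ℝ → ℝ} {c Λ : ℝ} (hw : Differentiable ℝ w) (hc : w c = 0)
    (hΛ : ∀ τ, |deriv w τ| ≤ Λ) (τ : ℝ) : |w τ| ≤ Λ * |τ - c| := by
  have h := convex_univ.norm_image_sub_le_of_norm_deriv_le (f := w) (fun x _ => hw x)
    (fun x _ => by rw [Real.norm_eq_abs]; exact hΛ x) (Set.mem_univ c) (Set.mem_univ τ)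
  rw [hc, sub_zero, Real.norm_eq_abs, Real.norm_eq_abs] at h
  exact h

/-- **FLOOR FOR FREE**: under the area law `w·A′ = (3/2 − w′)·A + 4` (`A > 0`, `w(c) = 0`) and the slip-slope bound `|w′| ≤ Λ`,
`4/Λ ≤ A(τ)` for EVERY `τ`: off the zero from the slip floor `4|τ − c| ≤ |w|·A ≤ Λ|τ − c|·A`, at the zero from `A(c) = 4/(w′(c) − 3/2)`
and `w′(c) ≤ Λ`. [folklore] -/
theorem areaLaw_floor_of_deriv_bound {w A : ℝ → ℝ} {c Λ : ℝ} (hw : Differentiable ℝ w) (hA : Differentiable ℝ A)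
    (hlaw : ∀ τ, w τ * deriv A τ = (3 / 2 - deriv w τ) * A τ + 4) (hpos : ∀ τ, 0 < A τ) (hc : w c = 0)
    (hΛ : ∀ τ, |deriv w τ| ≤ Λ) (τ : ℝ) : 4 / Λ ≤ A τ := by
  obtain ⟨hgt, hAc⟩ := areaLaw_core_at_zero hlaw hpos hc
  have hwc : deriv w c ≤ Λ := (le_abs_self _).trans (hΛ c)
  have hΛpos : 0 < Λ := by linarith
  rcases eq_or_ne τ c with rfl | hne
  · rw [hAc]
    exact div_le_div_of_nonneg_left (by norm_num) (by linarith) (by linarith)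
  · have hfl := areaLaw_slip_floor hw hA hlaw hpos hc τ
    have hsl := slip_abs_le_of_deriv_bound hw hc hΛ τ
    have hτc : 0 < |τ - c| := abs_pos.2 (sub_ne_zero.2 hne)
    have h1 : |w τ| * A τ ≤ Λ * |τ - c| * A τ := mul_le_mul_of_nonneg_right hsl (hpos τ).le
    have h2 : 4 * |τ - c| ≤ Λ * A τ * |τ - c| := by nlinarith
    have h3 : 4 ≤ Λ * A τ := le_of_mul_le_mul_right h2 hτc
    rw [div_le_iff₀ hΛpos]
    linarith [mul_comm Λ (A τ)]

/-- Corollary in the letter of `NearStraightJ1G`: `Λ⁻¹ ≤ A(τ)` (since `Λ⁻¹ ≤ 4/Λ`). [folklore] -/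
theorem areaLaw_inv_le_of_deriv_bound {w A : ℝ → ℝ} {c Λ : ℝ} (hw : Differentiable ℝ w) (hA : Differentiable ℝ A)
    (hlaw : ∀ τ, w τ * deriv A τ = (3 / 2 - deriv w τ) * A τ + 4) (hpos : ∀ τ, 0 < A τ) (hc : w c = 0)
    (hΛ : ∀ τ, |deriv w τ| ≤ Λ) (τ : ℝ) : Λ⁻¹ ≤ A τ := by
  have h := areaLaw_floor_of_deriv_bound hw hA hlaw hpos hc hΛ τ
  have hgt := (areaLaw_core_at_zero hlaw hpos hc).1
  have hΛpos : 0 < Λ := by linarith [(le_abs_self _).trans (hΛ c)]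
  have h4 : Λ⁻¹ ≤ 4 / Λ := by
    rw [inv_eq_one_div]
    exact div_le_div_of_nonneg_right (by norm_num) hΛpos.le
  exact h4.trans h

/-! ## 4. The AREA-LAW TWIN for the core radius (design note §3 (I2); appended 2026-08-31, same hand): with `μ = √(κ·Aa)` the law
`w·Aa′ = (3/2 − w′)·Aa + 4` reads `w·μ′ = (3/4 − w′/2)·μ + 2κ/μ` — the SAME averaged growth coefficient `β̄ = 3/4 − w′/2` as the J-averaged
local growth rate of a normal displacement (I1), plus the diffusion term `2κ/μ`: «displacement measured in core radii is damped along the slip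
flow at the viscous rate `2/Aa`» (brick B7 for the area-law variants A1α/A1G). -/

/-- Derivative of the matched core radius `μ = √(κ·A)` (`κ > 0`, `A > 0` differentiable): `μ′ = κ·A′/(2μ)`. [folklore] -/
theorem coreRadius_hasDerivAt {A : ℝ → ℝ} {κ : ℝ} (hκ : 0 < κ) (hA : Differentiable ℝ A) (hpos : ∀ τ, 0 < A τ) (τ : ℝ) :
    HasDerivAt (fun s => Real.sqrt (κ * A s)) (κ * deriv A τ / (2 * Real.sqrt (κ * A τ))) τ := by
  have hne : κ * A τ ≠ 0 := (mul_pos hκ (hpos τ)).ne'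
  have h := ((hA τ).hasDerivAt.const_mul κ).sqrt hne
  exact h

/-- **AREA-LAW TWIN** (design note (I2)): under `w·A′ = (3/2 − w′)·A + 4` the core radius `μ = √(κ·A)` obeys
`w·μ′ = (3/4 − w′/2)·μ + 2κ/μ`. [folklore] -/
theorem areaLaw_coreRadius {w A : ℝ → ℝ} {κ : ℝ} (hκ : 0 < κ) (hA : Differentiable ℝ A)
    (hlaw : ∀ τ, w τ * deriv A τ = (3 / 2 - deriv w τ) * A τ + 4) (hpos : ∀ τ, 0 < A τ) (τ : ℝ) :
    w τ * deriv (fun s => Real.sqrt (κ * A s)) τ =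
      (3 / 4 - deriv w τ / 2) * Real.sqrt (κ * A τ) + 2 * κ / Real.sqrt (κ * A τ) := by
  rw [(coreRadius_hasDerivAt hκ hA hpos τ).deriv]
  set μ : ℝ := Real.sqrt (κ * A τ) with hμ
  have hμpos : 0 < μ := Real.sqrt_pos.2 (mul_pos hκ (hpos τ))
  have hμsq : μ ^ 2 = κ * A τ := Real.sq_sqrt (mul_pos hκ (hpos τ)).le
  have key : w τ * (κ * deriv A τ) = κ * ((3 / 2 - deriv w τ) * A τ + 4) := by rw [← hlaw τ]; ring
  have key' : κ * A τ = μ ^ 2 := hμsq.symm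
  calc w τ * (κ * deriv A τ / (2 * μ)) = (w τ * (κ * deriv A τ)) / (2 * μ) := by ring
    _ = κ * ((3 / 2 - deriv w τ) * A τ + 4) / (2 * μ) := by rw [key]
    _ = ((3 / 2 - deriv w τ) * (κ * A τ) + 4 * κ) / (2 * μ) := by ring
    _ = ((3 / 2 - deriv w τ) * μ ^ 2 + 4 * κ) / (2 * μ) := by rw [key']
    _ = (3 / 4 - deriv w τ / 2) * μ + 2 * κ / μ := by field_simp; ring

/-- The same law as a damping statement for the ratio `q = ρ/μ` of a transported amplitude `ρ` (obeying `w·ρ′ = β̄·ρ + r` with the SAME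
coefficient `β̄ = 3/4 − w′/2`) to the core radius `μ = √(κ·A)`: `w·(ρ/μ)′ = −(2κ/μ²)·(ρ/μ) + r/μ` — pure damping at the rate
`2κ/μ² = 2/A`, with no sign condition on `β̄`. [folklore] -/
theorem areaLaw_ratio_damping {w A ρ : ℝ → ℝ} {κ r : ℝ} (hκ : 0 < κ) (hA : Differentiable ℝ A)
    (hlaw : ∀ τ, w τ * deriv A τ = (3 / 2 - deriv w τ) * A τ + 4) (hpos : ∀ τ, 0 < A τ) {τ ρ' : ℝ}
    (hρ : HasDerivAt ρ ρ' τ) (hρlaw : w τ * ρ' = (3 / 4 - deriv w τ / 2) * ρ τ + r) :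
    w τ * deriv (fun s => ρ s / Real.sqrt (κ * A s)) τ =
      -(2 * κ / (κ * A τ)) * (ρ τ / Real.sqrt (κ * A τ)) + r / Real.sqrt (κ * A τ) := by
  have hμd := coreRadius_hasDerivAt hκ hA hpos τ
  have e2 := areaLaw_coreRadius hκ hA hlaw hpos τ
  rw [hμd.deriv] at e2
  set μ' : ℝ := κ * deriv A τ / (2 * Real.sqrt (κ * A τ)) with hμ'
  have hμpos : 0 < Real.sqrt (κ * A τ) := Real.sqrt_pos.2 (mul_pos hκ (hpos τ))
  have hq : HasDerivAt (fun s => ρ s / Real.sqrt (κ * A s))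
      ((ρ' * Real.sqrt (κ * A τ) - ρ τ * μ') / Real.sqrt (κ * A τ) ^ 2) τ := hρ.div hμd hμpos.ne'
  rw [hq.deriv]
  set μ : ℝ := Real.sqrt (κ * A τ) with hμ
  have hμsq : κ * A τ = μ ^ 2 := (Real.sq_sqrt (mul_pos hκ (hpos τ)).le).symm
  rw [hμsq]
  calc w τ * ((ρ' * μ - ρ τ * μ') / μ ^ 2) = ((w τ * ρ') * μ - ρ τ * (w τ * μ')) / μ ^ 2 := by ring
    _ = (((3 / 4 - deriv w τ / 2) * ρ τ + r) * μ - ρ τ * ((3 / 4 - deriv w τ / 2) * μ + 2 * κ / μ)) / μ ^ 2 := by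
        rw [hρlaw, e2]
    _ = -(2 * κ / μ ^ 2) * (ρ τ / μ) + r / μ := by field_simp; ring

end Summit.NavierStokesRegularity.NavierStokesRegularity.Theorems.SkeletonJ1NormalBlockWindow

end
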